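import Mathlib
import Summits.Ventures.PercRepro2.Independence
import Summits.Ventures.PercRepro2.Harris
import Summits.Ventures.PercRepro2.HCov
import Summits.Ventures.PercRepro2.CutVertexPaths
import Summits.Ventures.PercRepro2.CutOneFarConn
import Summits.Ventures.PercRepro2.CutTwoFarConn
import Summits.Ventures.PercRepro2.CutTwoFarLaw

/-!
# Both roots behind a cut vertex, I: THE JOINT LAW OF THE PATTERN AND THE RIGHT BITS (blind cell
PercRepro2, typer-1 g50)

Towards the class theorem T1 of MINE2-CUTVERTEX.md §13.2 (S3.5, the role pair `{a₁, a₂}`): with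
`v` a cut vertex, the two roots `a₁, a₂` on the left and `o, a₃, b` on the right (or at `v`), the
connectivity between the marks is decided by the LEFT PATTERN `pat ω` (`CutTwoFarConn.lean`, with
`w₁ = a₁`, `w₂ = a₂`) and the three RIGHT BITS `Rb y ω = [v ↔ y by right edges]` for
`y = o, a₃, b` (`conn_root_right_iff`, `conn_roots_iff`).  The left pattern and the right bits are
independent, so for every event `S` that is a Boolean function `Φ` of them

  `P_p(S) = ∑_τ patProb τ · ∑_ρ [Φ τ ρ] · atom ρ`   (**`prob_pat_R`**),

with `atom ρ = P_p(Rb o = ρ₁, Rb a₃ = ρ₂, Rb b = ρ₃)` the eight right atoms (`atom_sum` = 1, and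
the right-only version `prob_R`).  Own work; standard axioms.
-/

namespace Summit.Ventures.PercRepro2

open CovForm CutVertexM9

namespace CutTwoFar

section RightBits

variable {V : Type*} {E : Type*} [Fintype E] [DecidableEq E] {R : Type*} [Field R]
variable (ends : E → Sym2 V) (side : E → Bool) (v : V)

open scoped Classical in
/-- The right bit of `y`: `v ↔ y` by right edges. -/
noncomputable def Rb (y : V) (ω : Config E) : Bool :=
  decide (Conn ends (CutVertexM9.restrict side false ω) v y)

omit [Fintype E] [DecidableEq E] in
/-- The right bit reads the right connection. -/
lemma Rb_eq_true_iff (y : V) (ω : Config E) :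
    Rb ends side v y ω = true ↔ Conn ends (CutVertexM9.restrict side false ω) v y := by
  simp [Rb]

omit [Fintype E] [DecidableEq E] in
/-- The right bits only read the right edges. -/
lemma Rb_eq_of_agree (y : V) {ω ω' : Config E} (hag : ∀ e, side e = false → ω e = ω' e) :
    Rb ends side v y ω = Rb ends side v y ω' := by
  unfold Rb
  rw [CutVertexM9.restrict_eq_of_agree hag]

variable (o a₃ b : V)

/-- The three right bits of `o, a₃, b`. -/
noncomputable def Rbits (ω : Config E) : Bool × Bool × Bool :=
  (Rb ends side v o ω, Rb ends side v a₃ ω, Rb ends side v b ω)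

/-- The eight right atoms: the law of the three right bits. -/
noncomputable def atom (p : E → R) (ρ : Bool × Bool × Bool) : R :=
  prob p {ω | Rbits ends side v o a₃ b ω = ρ}

omit [Fintype E] [DecidableEq E] in
/-- The right-bit events only read the right edges. -/
lemma dependsOn_Rbits (ρ : Bool × Bool × Bool) :
    DependsOn (· ∈ {ω : Config E | Rbits ends side v o a₃ b ω = ρ}) {e | side e = false} := by
  intro ω ω' h
  simp only [Set.mem_setOf_eq, Rbits]
  rw [Rb_eq_of_agree ends side v o h, Rb_eq_of_agree ends side v a₃ h, Rb_eq_of_agree ends side v b h]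

omit [Fintype E] [DecidableEq E] in
/-- The pattern events only read the left edges. -/
lemma dependsOn_pat (w₁ w₂ : V) (τ : Fin 3 → Bool) :
    DependsOn (· ∈ {ω : Config E | pat ends side v w₁ w₂ ω = τ}) {e | side e = true} := by
  intro ω ω' h
  simp only [Set.mem_setOf_eq]
  rw [pat_eq_of_agree ends side v w₁ w₂ h]

/-- **Independence of the left pattern and the right bits.** -/
theorem prob_pat_and_Rbits (w₁ w₂ : V) (p : E → R) (τ : Fin 3 → Bool) (ρ : Bool × Bool × Bool) :
    prob p {ω | pat ends side v w₁ w₂ ω = τ ∧ Rbits ends side v o a₃ b ω = ρ} =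
      patProb ends side v w₁ w₂ p τ * atom ends side v o a₃ b p ρ := by
  have hdisj : Disjoint {e | side e = true} {e | side e = false} := by
    rw [Set.disjoint_left]
    intro e he he'
    simp only [Set.mem_setOf_eq] at he he'
    rw [he] at he'
    exact Bool.false_ne_true he'.symm
  have hset : {ω : Config E | pat ends side v w₁ w₂ ω = τ ∧ Rbits ends side v o a₃ b ω = ρ} =
      {ω | pat ends side v w₁ w₂ ω = τ} ∩ {ω | Rbits ends side v o a₃ b ω = ρ} := by
    ext ω
    simp only [Set.mem_setOf_eq, Set.mem_inter_iff]
  rw [hset, prob_inter_eq_mul_of_dependsOn p hdisj (dependsOn_pat ends side v w₁ w₂ τ)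
    (dependsOn_Rbits ends side v o a₃ b ρ)]
  rfl

/-- The fibre decomposition of a probability along a map into a finite type. -/
lemma prob_eq_sum_fibres {ι : Type*} [Fintype ι] [DecidableEq ι] (p : E → R) (F : Config E → ι)
    (S : Set (Config E)) : prob p S = ∑ t, prob p (S ∩ {ω | F ω = t}) := by
  classical
  unfold prob
  rw [← Finset.sum_fiberwise Finset.univ F]
  refine Finset.sum_congr rfl fun t _ => ?_
  rw [Finset.sum_filter]
  refine Finset.sum_congr rfl fun ω _ => ?_
  by_cases hF : F ω = t
  · rw [if_pos hF]
    by_cases hS : ω ∈ S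
    · rw [Set.indicator_of_mem hS, Set.indicator_of_mem (show ω ∈ S ∩ {ω | F ω = t} from ⟨hS, hF⟩)]
    · rw [Set.indicator_of_notMem hS, Set.indicator_of_notMem (show ω ∉ S ∩ {ω | F ω = t} from
        fun h => hS h.1)]
  · rw [if_neg hF, Set.indicator_of_notMem (show ω ∉ S ∩ {ω | F ω = t} from fun h => hF h.2)]

/-- **The joint law, applied**: an event that is a Boolean function `Φ` of the left pattern and
the right bits has probability `∑_τ patProb τ · ∑_ρ [Φ τ ρ] · atom ρ`. -/
theorem prob_pat_R (w₁ w₂ : V) (p : E → R) (S : Set (Config E))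
    (Φ : (Fin 3 → Bool) → Bool × Bool × Bool → Prop) [∀ τ ρ, Decidable (Φ τ ρ)]
    (hS : ∀ ω, ω ∈ S ↔ Φ (pat ends side v w₁ w₂ ω) (Rbits ends side v o a₃ b ω)) :
    prob p S = ∑ τ, patProb ends side v w₁ w₂ p τ *
      ∑ ρ, if Φ τ ρ then atom ends side v o a₃ b p ρ else 0 := by
  classical
  rw [prob_eq_sum_fibres p (fun ω => (pat ends side v w₁ w₂ ω, Rbits ends side v o a₃ b ω)) S,
    Fintype.sum_prod_type]
  refine Finset.sum_congr rfl fun τ _ => ?_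
  rw [Finset.mul_sum]
  refine Finset.sum_congr rfl fun ρ _ => ?_
  by_cases hΦ : Φ τ ρ
  · rw [if_pos hΦ, ← prob_pat_and_Rbits]
    congr 1
    ext ω
    simp only [Set.mem_inter_iff, Set.mem_setOf_eq, Prod.mk.injEq, hS ω]
    constructor
    · rintro ⟨_, h1, h2⟩
      exact ⟨h1, h2⟩
    · rintro ⟨h1, h2⟩
      exact ⟨by rw [h1, h2]; exact hΦ, h1, h2⟩
  · rw [if_neg hΦ, mul_zero]
    have : S ∩ {ω | (pat ends side v w₁ w₂ ω, Rbits ends side v o a₃ b ω) = (τ, ρ)} = ∅ := by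
      ext ω
      simp only [Set.mem_inter_iff, Set.mem_setOf_eq, Prod.mk.injEq, Set.mem_empty_iff_false,
        iff_false, not_and, hS ω]
      intro hφ h1 h2
      rw [h1, h2] at hφ
      exact hΦ hφ
    rw [this, prob_empty]

/-- **The right-only law**: an event that is a Boolean function of the right bits alone. -/
theorem prob_R (p : E → R) (S : Set (Config E)) (Φ : Bool × Bool × Bool → Prop)
    [∀ ρ, Decidable (Φ ρ)] (hS : ∀ ω, ω ∈ S ↔ Φ (Rbits ends side v o a₃ b ω)) :
    prob p S = ∑ ρ, if Φ ρ then atom ends side v o a₃ b p ρ else 0 := by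
  classical
  rw [prob_eq_sum_fibres p (Rbits ends side v o a₃ b) S]
  refine Finset.sum_congr rfl fun ρ _ => ?_
  by_cases hΦ : Φ ρ
  · rw [if_pos hΦ, atom]
    congr 1
    ext ω
    simp only [Set.mem_inter_iff, Set.mem_setOf_eq, hS ω]
    constructor
    · rintro ⟨_, h⟩
      exact h
    · intro h
      exact ⟨by rw [h]; exact hΦ, h⟩
  · rw [if_neg hΦ]
    have : S ∩ {ω | Rbits ends side v o a₃ b ω = ρ} = ∅ := by
      ext ω
      simp only [Set.mem_inter_iff, Set.mem_setOf_eq, Set.mem_empty_iff_false, iff_false, not_and,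
        hS ω]
      intro hφ h
      rw [h] at hφ
      exact hΦ hφ
    rw [this, prob_empty]

/-- **The atoms sum to one.** -/
theorem atom_sum (p : E → R) : ∑ ρ, atom ends side v o a₃ b p ρ = 1 := by
  have h := prob_R ends side v o a₃ b p Set.univ (fun _ => True) (fun _ => by simp)
  simp only [prob_univ, if_true] at h
  exact h.symm

end RightBits

/-! ## Mark connectivity with both roots on the left -/

section Roots

variable {V : Type*} {E : Type*} {ends : E → Sym2 V} {side : E → Bool} {L : Set V} {v : V}
  {Rt : Set V}

/-- A left mark `w` and a right vertex `y`: joined iff `w ↔ v` by left edges and `v ↔ y` by right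
edges. -/
lemma conn_left_right_iff (h : CutVertex ends side L v Rt) {w : V} (hw : w ∈ L ∨ w = v) {y : V}
    (hy : y ∈ Rt ∨ y = v) (ω : Config E) :
    Conn ends ω w y ↔
      Conn ends (CutVertexM9.restrict side true ω) w v ∧ Rb ends side v y ω = true := by
  rw [conn_cross_iff h hw hy ω, conn_iff_restrict_left h hw (Or.inr rfl) ω,
    conn_iff_restrict_right h hy (Or.inr rfl) ω, Rb_eq_true_iff]
  constructor
  · rintro ⟨h1, h2⟩
    exact ⟨h1, conn_symm h2⟩
  · rintro ⟨h1, h2⟩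
    exact ⟨h1, conn_symm h2⟩

variable (h : CutVertex ends side L v Rt) {a₁ a₂ : V} (h₁ : a₁ ∈ L ∨ a₁ = v) (h₂ : a₂ ∈ L ∨ a₂ = v)
  {y : V} (hy : y ∈ Rt ∨ y = v) (ω : Config E)
include h h₁ h₂

omit h₂ in
include hy in
/-- `a₁ ↔ y` iff the pattern bit `0` and the right bit of `y`. -/
lemma conn_a₁_iff : Conn ends ω a₁ y ↔
    pat ends side v a₁ a₂ ω 0 = true ∧ Rb ends side v y ω = true := by
  rw [conn_left_right_iff h h₁ hy ω, pat_zero_iff]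

omit h₂ in
include hy in
/-- `y ↔ a₁`, mirror. -/
lemma conn_a₁_iff' : Conn ends ω y a₁ ↔
    pat ends side v a₁ a₂ ω 0 = true ∧ Rb ends side v y ω = true := by
  rw [← conn_a₁_iff h h₁ hy ω (a₂ := a₂)]
  exact ⟨conn_symm, conn_symm⟩

omit h₁ in
include hy in
/-- `a₂ ↔ y` iff the pattern bit `1` and the right bit of `y`. -/
lemma conn_a₂_iff : Conn ends ω a₂ y ↔
    pat ends side v a₁ a₂ ω 1 = true ∧ Rb ends side v y ω = true := by
  rw [conn_left_right_iff h h₂ hy ω, pat_one_iff]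

omit h₁ in
include hy in
/-- `y ↔ a₂`, mirror. -/
lemma conn_a₂_iff' : Conn ends ω y a₂ ↔
    pat ends side v a₁ a₂ ω 1 = true ∧ Rb ends side v y ω = true := by
  rw [← conn_a₂_iff h h₂ hy ω (a₁ := a₁)]
  exact ⟨conn_symm, conn_symm⟩

/-- `a₁ ↔ a₂` iff the pattern bit `2`. -/
lemma conn_a₁_a₂_iff : Conn ends ω a₁ a₂ ↔ pat ends side v a₁ a₂ ω 2 = true := by
  rw [conn_iff_restrict_left h h₁ h₂ ω, pat_two_iff]

/-- `a₂ ↔ a₁` iff the pattern bit `2`. -/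
lemma conn_a₂_a₁_iff : Conn ends ω a₂ a₁ ↔ pat ends side v a₁ a₂ ω 2 = true := by
  rw [← conn_a₁_a₂_iff h h₁ h₂ ω]
  exact ⟨conn_symm, conn_symm⟩

end Roots

end CutTwoFar

end Summit.Ventures.PercRepro2
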